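import Mathlib
import HarnessLib

/-!
# Tschebyscheff systems and numerical integration (Davis–Rabinowitz 1984, Sect. 2.7.7)

Davis–Rabinowitz, *Methods of Numerical Integration* (2nd ed., 1984), Sect. 2.7.7 "Tschebyscheff Systems and
Numerical Integration" (after Karlin–Studden).

* **Definition 1 (2.7.7.1).**  `n` real functions `u₁, …, uₙ` continuous on `[a, b]` form a *Tschebyscheff system*
  over `[a, b]` if the collocation determinants `det (uᵢ(tⱼ))` at any `n` points `a ≤ t₁ < ⋯ < tₙ ≤ b` all have
  one and the same strict sign `εₙ = ±1` (`IsTchebycheffSystem`, `collocationMatrix`).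
* **Theorem 1.**  Every nonzero function of the real span of a Tschebyscheff system has at most `n - 1` distinct
  roots in `[a, b]` (`IsTchebycheffSystem.eq_zero_of_eval_eq_zero`: vanishing at `n` increasing points forces all
  coefficients to vanish; `IsTchebycheffSystem.card_roots_lt` / `card_roots_le`: a finite root set in `[a, b]` has
  fewer than `n` elements).  Consequence used for generalized (non-polynomial) Gauss rules: interpolation by the
  span at `n` increasing nodes is uniquely solvable (`IsTchebycheffSystem.existsUnique_interpolant`).
* **Examples.**  The powers `1, t, …, t^{n-1}` form a Tschebyscheff system over every `[a, b]` with `εₙ = 1`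
  (`isTchebycheffSystem_pow`, the Vandermonde determinant), whence (2.7.7.6) is the classical Gauss case; and a
  genuinely non-polynomial system, `{1, eᵗ}` (`isTchebycheffSystem_one_exp`).

Not formalised here: the confluent inequality (2.7.7.2), the moment cone `Mₙ` and its representations
(Theorems 3–6, (2.7.7.3)-(2.7.7.5)), which need the Karlin–Studden convexity theory.

No `sorry`; standard axioms only.
-/

noncomputable section

open Matrix Finset

namespace Literature.Analysis.Quadrature

variable {n : ℕ}

/-! ### Definition 1 -/

/-- The collocation matrix `(uᵢ(tⱼ))_{i,j}` of `n` functions at `n` points.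
[cite: DavisRabinowitz1984, Sect. 2.7.7 (2.7.7.1)] -/
def collocationMatrix (u : Fin n → ℝ → ℝ) (t : Fin n → ℝ) : Matrix (Fin n) (Fin n) ℝ :=
  Matrix.of fun i j => u i (t j)

/-- [cite: DavisRabinowitz1984, Sect. 2.7.7 (2.7.7.1)] -/
@[simp] theorem collocationMatrix_apply (u : Fin n → ℝ → ℝ) (t : Fin n → ℝ) (i j : Fin n) :
    collocationMatrix u t i j = u i (t j) := rfl

/-- **Definition 1** (2.7.7.1): `u₁, …, uₙ`, continuous on `[a, b]`, form a Tschebyscheff system over `[a, b]`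
if there is a sign `ε = ±1`, independent of the points, with `ε · det (uᵢ(tⱼ)) > 0` for every choice of
`n` points `a ≤ t₁ < ⋯ < tₙ ≤ b`. [cite: DavisRabinowitz1984, Sect. 2.7.7 (2.7.7.1), Definition 1] -/
def IsTchebycheffSystem (u : Fin n → ℝ → ℝ) (a b : ℝ) : Prop :=
  (∀ i, ContinuousOn (u i) (Set.Icc a b)) ∧
    ∃ ε : ℝ, (ε = 1 ∨ ε = -1) ∧
      ∀ t : Fin n → ℝ, StrictMono t → (∀ j, t j ∈ Set.Icc a b) → 0 < ε * (collocationMatrix u t).det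

/-- The element `g = Σᵢ cᵢ uᵢ` of the real span, evaluated at `x`.
[cite: DavisRabinowitz1984, Sect. 2.7.7 (Theorem 1)] -/
def spanEval (c : Fin n → ℝ) (u : Fin n → ℝ → ℝ) (x : ℝ) : ℝ := ∑ i, c i * u i x

/-- The row vector `c` times the collocation matrix lists the values of `Σ cᵢ uᵢ` at the points.
[cite: DavisRabinowitz1984, Sect. 2.7.7 (2.7.7.1)] -/
theorem vecMul_collocationMatrix (c : Fin n → ℝ) (u : Fin n → ℝ → ℝ) (t : Fin n → ℝ) :
    c ᵥ* collocationMatrix u t = fun j => spanEval c u (t j) := by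
  funext j
  simp [Matrix.vecMul, dotProduct, spanEval]

/-- A Tschebyscheff system has nonvanishing collocation determinants.
[cite: DavisRabinowitz1984, Sect. 2.7.7 (2.7.7.1)] -/
theorem IsTchebycheffSystem.det_ne_zero {u : Fin n → ℝ → ℝ} {a b : ℝ} (h : IsTchebycheffSystem u a b)
    {t : Fin n → ℝ} (ht : StrictMono t) (hmem : ∀ j, t j ∈ Set.Icc a b) :
    (collocationMatrix u t).det ≠ 0 := by
  obtain ⟨ε, -, hε⟩ := h.2
  intro h0
  have := hε t ht hmem
  rw [h0, mul_zero] at this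
  exact lt_irrefl _ this

/-! ### Theorem 1: at most `n - 1` roots -/

/-- **Theorem 1**, collocation form: if `g = Σ cᵢ uᵢ` vanishes at `n` points `a ≤ t₁ < ⋯ < tₙ ≤ b` of a
Tschebyscheff system, then all `cᵢ = 0`. [cite: DavisRabinowitz1984, Sect. 2.7.7 (Theorem 1)] -/
theorem IsTchebycheffSystem.eq_zero_of_eval_eq_zero {u : Fin n → ℝ → ℝ} {a b : ℝ}
    (h : IsTchebycheffSystem u a b) {t : Fin n → ℝ} (ht : StrictMono t) (hmem : ∀ j, t j ∈ Set.Icc a b)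
    {c : Fin n → ℝ} (hz : ∀ j, spanEval c u (t j) = 0) : c = 0 :=
  Matrix.eq_zero_of_vecMul_eq_zero (h.det_ne_zero ht hmem)
    (by rw [vecMul_collocationMatrix]; funext j; exact hz j)

/-- **Theorem 1** (2.7.7): a nonzero function of the span of a Tschebyscheff system over `[a, b]` has fewer than
`n` distinct roots in `[a, b]` — every finite set of its roots in `[a, b]` has `< n` elements.
[cite: DavisRabinowitz1984, Sect. 2.7.7 (Theorem 1)] -/
theorem IsTchebycheffSystem.card_roots_lt {u : Fin n → ℝ → ℝ} {a b : ℝ} (h : IsTchebycheffSystem u a b)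
    {c : Fin n → ℝ} (hc : c ≠ 0) {s : Finset ℝ}
    (hs : ∀ x ∈ s, x ∈ Set.Icc a b ∧ spanEval c u x = 0) : s.card < n := by
  by_contra hge
  obtain ⟨s', hsub, hcard⟩ := Finset.exists_subset_card_eq (s := s) (not_lt.mp hge)
  set t : Fin n → ℝ := fun j => s'.orderEmbOfFin hcard j
  have ht : StrictMono t := (s'.orderEmbOfFin hcard).strictMono
  have hmem' : ∀ j, t j ∈ s := fun j => hsub (s'.orderEmbOfFin_mem hcard j)
  exact hc (h.eq_zero_of_eval_eq_zero ht (fun j => (hs _ (hmem' j)).1) fun j => (hs _ (hmem' j)).2)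

/-- **Theorem 1** in the text's wording: at most `n - 1` distinct roots in `[a, b]`.
[cite: DavisRabinowitz1984, Sect. 2.7.7 (Theorem 1)] -/
theorem IsTchebycheffSystem.card_roots_le {u : Fin n → ℝ → ℝ} {a b : ℝ} (h : IsTchebycheffSystem u a b)
    {c : Fin n → ℝ} (hc : c ≠ 0) {s : Finset ℝ}
    (hs : ∀ x ∈ s, x ∈ Set.Icc a b ∧ spanEval c u x = 0) : s.card ≤ n - 1 := by
  have := h.card_roots_lt hc hs
  omega

/-- Unisolvence: over a Tschebyscheff system, interpolation at `n` increasing nodes of `[a, b]` has exactly one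
solution in the span (the collocation matrix is invertible). [cite: DavisRabinowitz1984, Sect. 2.7.7 (Theorem 1)] -/
theorem IsTchebycheffSystem.existsUnique_interpolant {u : Fin n → ℝ → ℝ} {a b : ℝ}
    (h : IsTchebycheffSystem u a b) {t : Fin n → ℝ} (ht : StrictMono t) (hmem : ∀ j, t j ∈ Set.Icc a b)
    (y : Fin n → ℝ) : ∃! c : Fin n → ℝ, ∀ j, spanEval c u (t j) = y j := by
  have hU : IsUnit (collocationMatrix u t) :=
    (Matrix.isUnit_iff_isUnit_det _).mpr (isUnit_iff_ne_zero.mpr (h.det_ne_zero ht hmem))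
  obtain ⟨c, hc⟩ := Matrix.vecMul_surjective_iff_isUnit.mpr hU y
  have hc : c ᵥ* collocationMatrix u t = y := hc
  refine ⟨c, fun j => ?_, fun c' hc' => ?_⟩
  · have := congrFun hc j
    rwa [vecMul_collocationMatrix] at this
  · have hc' : ∀ j, spanEval c' u (t j) = y j := hc'
    apply Matrix.vecMul_injective_iff_isUnit.mpr hU
    show c' ᵥ* collocationMatrix u t = c ᵥ* collocationMatrix u t
    rw [hc, vecMul_collocationMatrix]
    funext j
    exact hc' j

/-! ### Examples: powers (Vandermonde) and `{1, eᵗ}` -/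

/-- The collocation matrix of the powers `tⁱ`, `i = 0, …, n-1`, is the transposed Vandermonde matrix.
[cite: DavisRabinowitz1984, Sect. 2.7.7 (2.7.7.6)] -/
theorem collocationMatrix_pow (t : Fin n → ℝ) :
    collocationMatrix (fun (i : Fin n) (x : ℝ) => x ^ (i : ℕ)) t = (Matrix.vandermonde t)ᵀ := by
  ext i j
  simp [Matrix.vandermonde_apply]

/-- The powers `1, t, …, t^{n-1}` form a Tschebyscheff system over every `[a, b]`, with `εₙ = 1`: the Vandermonde
determinant `∏_{i<j} (tⱼ - tᵢ)` is positive at increasing points. [cite: DavisRabinowitz1984, Sect. 2.7.7 (2.7.7.6)] -/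
theorem isTchebycheffSystem_pow (n : ℕ) (a b : ℝ) :
    IsTchebycheffSystem (fun (i : Fin n) (x : ℝ) => x ^ (i : ℕ)) a b := by
  refine ⟨fun i => (continuous_pow _).continuousOn, 1, Or.inl rfl, fun t ht _ => ?_⟩
  rw [one_mul, collocationMatrix_pow, Matrix.det_transpose, Matrix.det_vandermonde]
  exact Finset.prod_pos fun i _ => Finset.prod_pos fun j hj => sub_pos.mpr (ht (Finset.mem_Ioi.mp hj))

/-- Consequently a nonzero `Σ_{i<n} cᵢ tⁱ` has at most `n - 1` roots in any `[a, b]` — the polynomial case of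
Theorem 1, recovered from the Tschebyscheff-system machinery. [cite: DavisRabinowitz1984, Sect. 2.7.7 (Theorem 1)] -/
theorem card_roots_le_of_pow {c : Fin n → ℝ} (hc : c ≠ 0) (a b : ℝ) {s : Finset ℝ}
    (hs : ∀ x ∈ s, x ∈ Set.Icc a b ∧ ∑ i : Fin n, c i * x ^ (i : ℕ) = 0) : s.card ≤ n - 1 :=
  (isTchebycheffSystem_pow n a b).card_roots_le hc hs

/-- A non-polynomial Tschebyscheff system: `{1, eᵗ}` over every `[a, b]` (`ε₂ = 1`, since
`det [[1, 1], [e^{t₁}, e^{t₂}]] = e^{t₂} - e^{t₁} > 0` for `t₁ < t₂`).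
[cite: DavisRabinowitz1984, Sect. 2.7.7 (2.7.7.1)] -/
theorem isTchebycheffSystem_one_exp (a b : ℝ) :
    IsTchebycheffSystem ![fun _ : ℝ => (1 : ℝ), Real.exp] a b := by
  refine ⟨fun i => ?_, 1, Or.inl rfl, fun t ht _ => ?_⟩
  · fin_cases i
    · exact continuousOn_const
    · exact Real.continuous_exp.continuousOn
  · rw [one_mul, Matrix.det_fin_two]
    simp only [collocationMatrix_apply, Matrix.cons_val_zero, Matrix.cons_val_one]
    have h01 : t 0 < t 1 := ht (by decide)
    nlinarith [Real.exp_lt_exp.mpr h01]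

/-- Hence `c₀ + c₁ eᵗ` (not both coefficients zero) has at most one root in any interval.
[cite: DavisRabinowitz1984, Sect. 2.7.7 (Theorem 1)] -/
theorem card_roots_le_one_of_one_exp {c : Fin 2 → ℝ} (hc : c ≠ 0) (a b : ℝ) {s : Finset ℝ}
    (hs : ∀ x ∈ s, x ∈ Set.Icc a b ∧ c 0 + c 1 * Real.exp x = 0) : s.card ≤ 1 := by
  have := (isTchebycheffSystem_one_exp a b).card_roots_le hc (s := s) fun x hx => ⟨(hs x hx).1, by
    have := (hs x hx).2
    simpa [spanEval, Fin.sum_univ_two] using this⟩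
  simpa using this

/-! ### (2.7.7.5): rules precise on the span -/

/-- (2.7.7.5): an integration rule `R(f) = Σₖ Aₖ f(τₖ)` which reproduces the generalized moments
`Iᵢ` of each `uᵢ` is precise on the whole real span: `R(Σ cᵢ uᵢ) = Σ cᵢ Iᵢ`.
[cite: DavisRabinowitz1984, Sect. 2.7.7 (2.7.7.4)-(2.7.7.5)] -/
theorem rule_spanEval_eq {r : ℕ} (A τ : Fin r → ℝ) (u : Fin n → ℝ → ℝ) (I : Fin n → ℝ)
    (hex : ∀ i, ∑ k, A k * u i (τ k) = I i) (c : Fin n → ℝ) :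
    ∑ k, A k * spanEval c u (τ k) = ∑ i, c i * I i := by
  simp only [spanEval, Finset.mul_sum]
  rw [Finset.sum_comm]
  refine Finset.sum_congr rfl fun i _ => ?_
  rw [← hex i, Finset.mul_sum]
  refine Finset.sum_congr rfl fun k _ => ?_
  ring

/-- (2.7.7.5) for `dσ = w(t) dt`: a rule precise for each `uᵢ` against the weight `w` integrates every element of
the span exactly. [cite: DavisRabinowitz1984, Sect. 2.7.7 (2.7.7.4)-(2.7.7.5)] -/
theorem rule_spanEval_eq_integral {r : ℕ} (A τ : Fin r → ℝ) (u : Fin n → ℝ → ℝ) (w : ℝ → ℝ) (a b : ℝ)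
    (hint : ∀ i, IntervalIntegrable (fun x => u i x * w x) MeasureTheory.volume a b)
    (hex : ∀ i, ∑ k, A k * u i (τ k) = ∫ x in a..b, u i x * w x) (c : Fin n → ℝ) :
    ∑ k, A k * spanEval c u (τ k) = ∫ x in a..b, spanEval c u x * w x := by
  rw [rule_spanEval_eq A τ u _ hex c]
  have : (fun x => spanEval c u x * w x) = fun x => ∑ i, c i * (u i x * w x) := by
    funext x; simp only [spanEval, Finset.sum_mul]; refine Finset.sum_congr rfl fun i _ => ?_; ring
  rw [this, intervalIntegral.integral_finsetSum]
  · refine Finset.sum_congr rfl fun i _ => ?_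
    rw [intervalIntegral.integral_const_mul]
  · exact fun i _ => (hint i).const_mul (c i)

end Literature.Analysis.Quadrature
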